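import Mathlib
import Literature.Combinatorics.Optimization.CorrelationPolytopeGridMinor
import Literature.Combinatorics.Optimization.CorrelationPolytopeFaces
import Literature.Combinatorics.Optimization.CorrelationFaceGates
import HarnessLib

/-!
# The crossover block of the grid face of `COR(G_{t,t})` projecting onto `COR(K_h)`

Aboulker–Fiorini–Huynh–Macchia–Seif prove `xc(COR(G)) ≥ 2^{Ω(h)}` for graphs with an `h × h` grid
minor (their Theorem 6 and the remark after Theorem 3) by exhibiting "a face of `COR(H)` which projects to
the correlation polytope of the complete bipartite graph `K_{h,h}`", `H` a "grid with gadgets": the value of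
each left / bottom vertex "propagates along the corresponding vertical and horizontal path" through wire
equations `x_i = x_j = x_{ij}`, and at every crossing a constant-size CROSSOVER gadget (derived from
Lichtenstein's planar-3SAT crossover) "make[s] sure that propagation along vertical paths does not
interfere with propagation along horizontal paths", all constraints being "equations [that] originate
from valid inequalities" [AboulkerEtAl2019, proof of Thm. 6, p. 5 L53 – p. 6 L19].

This file is the tree's crossover gadget for that construction, written IN PLACE on a `16 × 16` block of
grid cells as rows over `corVec G b` for an arbitrary graph `G` and an arbitrary cell map
`ι : Fin 16 × Fin 16 → V` (the grid instantiation, with `ι (r,c) = (16i + r, 16j + c)`, is done in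
`GridCorCliqueFace.lean`; the only thing asked of `ι` is adjacency of the listed cell pairs,
`crossEdges_localAdj`).  The gadget is NOT the printed one: it is the standard planar crossover made of
three XOR gates (`C = A ⊕ B` at the centre, `A' = C ⊕ B` exits right, `B' = C ⊕ A` exits on top), each XOR
being four NAND gates, and each NAND gate being ONE valid inequality of `COR(G)` on a grid `4`-cycle
(`Literature.Combinatorics.Optimization.nandRow`, `CorrelationFaceGates.lean`); wires are the printed
`x_u = x_{uv} = x_v` rows (`CorrelationPolytopeFaces.lean`).  Machine-generated data (the layout was
found and exhaustively checked by a script — every constrained pair grid-adjacent, every wire connected,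
exactly one satisfying assignment per input pair `(A,B)`, and it has `A' = A`, `B' = B`): `crossSigNat`
(role cell ↦ signal), `crossSigVal` (signal ↦ truth table in `(A,B)`), `crossRep`, `crossWirePairs`
(97 same-signal adjacent pairs in BFS order), `crossGates` (12 NAND `4`-cycles); and the same for the
gate-free JUNCTION block of the diagonal (row `8` ∪ column `4` as one wire).  Proved interface, for
`b : V → Bool` and the row family `crossCv G ι` / `crossRhs` (indexed by `CrossIx`):

* (V) `cross_valid` — every row is valid on every generator `corVec G b`;
* (D) `cross_desc` — if all rows are tight at `corVec G b` then right port = left port, top port = bottom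
  port, and the readout cells `rdA ~ rdB` carry (left, bottom) (SOUNDNESS: the crossover transmits);
* (L) `cross_lift` — the explicit assignment `crossVal · x y` makes every row tight (COMPLETENESS),
  with `crossVal` equal to `x` on the left/right ports and `rdA`, to `y` on top/bottom and `rdB`;
* `junc_valid`, `junc_desc`, `junc_lift` likewise; `crossEdges_localAdj`, `juncEdges_localAdj` — all
  constrained pairs are unit steps of the `16 × 16` grid (one `decide`).

Ports: left `(8,0)`, right `(8,15)`, top `(0,4)`, bottom `(15,4)` in both blocks, so that horizontally /
vertically consecutive blocks are joined by one grid edge.  No named fact.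

## References

* P. Aboulker, S. Fiorini, T. Huynh, M. Macchia, J. Seif, *Extension complexity of the correlation
  polytope*, Oper. Res. Lett. 47 (2019) 47–51 = arXiv:1806.00541, §2 (grid with gadgets, p. 5 L21–33) and
  proof of Theorem 6 (p. 5 L49 – p. 6 L22; Fig. 4(b) crossover gadget).  Bib key `AboulkerEtAl2019`.
* D. Lichtenstein, *Planar formulae and their uses*, SIAM J. Comput. 11 (1982) 329–343 — the printed
  gadget's source (credit only; not used here).
-/

noncomputable section

namespace Literature.Combinatorics.Optimization

namespace GridCorBlock

open Matrix Finset

/-- Cells of a `16 × 16` block (row, column). [cite: AboulkerEtAl2019, proof of Thm. 6 (p. 5 L53 – p. 6 L19), crossover gadget — this file's NAND/XOR version, not the printed one] -/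
abbrev Cell : Type := Fin 16 × Fin 16

/-- Unit steps of the block grid: same row and columns differ by one, or same column and rows differ by
one — the offset form of the tree's `gridAdj` (`GridCoordinates.lean`). [cite: AboulkerEtAl2019, §2 (p. 5 L21: "(a,b) is adjacent to (a',b') if and only if |a−a'|+|b−b'| = 1")] -/
abbrev LocalAdj (p q : Cell) : Prop :=
  (p.1.val = q.1.val ∧ (p.2.val + 1 = q.2.val ∨ q.2.val + 1 = p.2.val)) ∨
    (p.2.val = q.2.val ∧ (p.1.val + 1 = q.1.val ∨ q.1.val + 1 = p.1.val))

/-- The four cycle edges `u v`, `v w`, `w z`, `z u` of each gate `(u, v, w, z)`. [cite: AboulkerEtAl2019, proof of Thm. 6 (p. 5 L53 – p. 6 L19), crossover gadget — this file's NAND/XOR version, not the printed one] -/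
def gateEdges (gs : List (Cell × Cell × Cell × Cell)) : List (Cell × Cell) :=
  gs.flatMap fun g => [(g.1, g.2.1), (g.2.1, g.2.2.1), (g.2.2.1, g.2.2.2), (g.2.2.2, g.1)]

/-- Membership of the four cycle edges. [cite: AboulkerEtAl2019, proof of Thm. 6 (p. 5 L53 – p. 6 L19), crossover gadget — this file's NAND/XOR version, not the printed one] -/
private theorem mem_gateEdges {gs : List (Cell × Cell × Cell × Cell)} {g : Cell × Cell × Cell × Cell}
    (hg : g ∈ gs) :
    (g.1, g.2.1) ∈ gateEdges gs ∧ (g.2.1, g.2.2.1) ∈ gateEdges gs ∧ (g.2.2.1, g.2.2.2) ∈ gateEdges gs ∧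
      (g.2.2.2, g.1) ∈ gateEdges gs := by
  refine ⟨?_, ?_, ?_, ?_⟩ <;> exact List.mem_flatMap.2 ⟨g, hg, by simp⟩

/-- BFS certificate of a wire-pair list: every pair joins two cells with the same representative, and its
first cell is a representative or occurs in an earlier pair. [cite: AboulkerEtAl2019, proof of Thm. 6 (p. 5 L53 – p. 6 L19), crossover gadget — this file's NAND/XOR version, not the printed one] -/
def wireOrderOK (pairs : List (Cell × Cell)) (rep : Cell → Cell) : Bool :=
  (List.range pairs.length).all fun n =>
    match pairs[n]? with
    | none => true
    | some (p, q) =>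
      (rep q == rep p) &&
        (p == rep p || (List.range n).any fun m =>
          match pairs[m]? with
          | some (p', q') => p == p' || p == q'
          | none => false)

/-- **Wire contraction.**  If the pairs are BFS-ordered (`wireOrderOK`) and a Boolean assignment agrees
across every pair, then every cell occurring in a pair carries the value of its representative — the printed
"the value of `x_i` propagates" along each wire. [cite: AboulkerEtAl2019, proof of Thm. 6 (p. 6 L17–19)] -/
private theorem reach (pairs : List (Cell × Cell)) (rep : Cell → Cell) (hok : wireOrderOK pairs rep = true)
    (β : Cell → Bool) (hw : ∀ n (h : n < pairs.length), β (pairs[n]).1 = β (pairs[n]).2) :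
    ∀ n (h : n < pairs.length),
      β (pairs[n]).1 = β (rep (pairs[n]).1) ∧ β (pairs[n]).2 = β (rep (pairs[n]).2) := by
  intro n
  induction n using Nat.strong_induction_on with
  | _ n ih =>
    intro hn
    have hall := List.all_eq_true.1 hok n (List.mem_range.2 hn)
    rw [List.getElem?_eq_getElem hn] at hall
    rcases hpq : pairs[n] with ⟨p, q⟩
    rw [hpq] at hall
    simp only [Bool.and_eq_true, beq_iff_eq, Bool.or_eq_true, List.any_eq_true, List.mem_range] at hall
    obtain ⟨hrep, hfirst⟩ := hall
    have hwn : β p = β q := by have := hw n hn; rwa [hpq] at this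
    have hp : β p = β (rep p) := by
      rcases hfirst with h | ⟨m, hm, hm'⟩
      · rw [← h]
      · have hml : m < pairs.length := lt_trans hm hn
        rw [List.getElem?_eq_getElem hml] at hm'
        obtain ⟨h1, h2⟩ := ih m hm hml
        rcases hpm : pairs[m] with ⟨p', q'⟩
        rw [hpm] at hm' h1 h2
        simp only [beq_iff_eq, Bool.or_eq_true] at hm'
        rcases hm' with rfl | rfl
        · exact h1
        · exact h2
    exact ⟨hp, by rw [← hwn, hp, hrep]⟩

/-- A cell occurring anywhere in the pair list carries the value of its representative. [cite: AboulkerEtAl2019, proof of Thm. 6 (p. 6 L17–19)] -/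
private theorem reach_cell (pairs : List (Cell × Cell)) (rep : Cell → Cell) (hok : wireOrderOK pairs rep = true)
    (β : Cell → Bool) (hw : ∀ n (h : n < pairs.length), β (pairs[n]).1 = β (pairs[n]).2) (c : Cell)
    (hc : ∃ n, ∃ h : n < pairs.length, (pairs[n]).1 = c ∨ (pairs[n]).2 = c) : β c = β (rep c) := by
  obtain ⟨n, hn, h⟩ := hc
  obtain ⟨h1, h2⟩ := reach pairs rep hok β hw n hn
  rcases h with rfl | rfl
  · exact h1
  · exact h2


/-! #### Data of the cross block (generated from `crossover_block_K16.json` by `gen_g4.py`) -/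

/-- Signal index of a role cell of the cross block (`none` = unconstrained cell); row-major two-level
table. [cite: AboulkerEtAl2019, proof of Thm. 6 (p. 5 L53 – p. 6 L19), crossover gadget — this file's NAND/XOR version, not the printed one] -/
def crossSigNat : ℕ → ℕ → Option (Fin 14)
  | 0, 4 => some 13
  | 1, 4 => some 13
  | 1, 5 => some 13
  | 2, 1 => some 10
  | 2, 2 => some 10
  | 2, 3 => some 10
  | 2, 4 => some 10
  | 2, 5 => some 11
  | 2, 6 => some 11
  | 2, 7 => some 11
  | 3, 1 => some 0
  | 3, 2 => some 9
  | 3, 3 => some 9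
  | 3, 4 => some 9
  | 3, 5 => some 9
  | 3, 6 => some 9
  | 3, 7 => some 2
  | 4, 1 => some 0
  | 4, 3 => some 9
  | 4, 4 => some 9
  | 4, 7 => some 2
  | 5, 1 => some 0
  | 5, 2 => some 0
  | 5, 3 => some 0
  | 5, 4 => some 2
  | 5, 5 => some 2
  | 5, 6 => some 2
  | 5, 7 => some 2
  | 5, 8 => some 2
  | 5, 9 => some 2
  | 5, 10 => some 2
  | 5, 11 => some 2
  | 5, 12 => some 2
  | 5, 13 => some 7
  | 6, 0 => some 0
  | 6, 1 => some 0
  | 6, 7 => some 2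
  | 6, 10 => some 2
  | 6, 12 => some 6
  | 6, 13 => some 7
  | 7, 0 => some 0
  | 7, 7 => some 2
  | 7, 10 => some 2
  | 7, 11 => some 6
  | 7, 12 => some 6
  | 7, 13 => some 7
  | 8, 0 => some 0
  | 8, 1 => some 0
  | 8, 2 => some 0
  | 8, 3 => some 0
  | 8, 4 => some 0
  | 8, 5 => some 0
  | 8, 6 => some 4
  | 8, 7 => some 2
  | 8, 10 => some 1
  | 8, 11 => some 6
  | 8, 12 => some 6
  | 8, 13 => some 7
  | 8, 14 => some 12
  | 8, 15 => some 12
  | 9, 3 => some 0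
  | 9, 5 => some 3
  | 9, 6 => some 4
  | 9, 7 => some 2
  | 9, 10 => some 1
  | 9, 12 => some 6
  | 9, 13 => some 8
  | 9, 14 => some 12
  | 10, 3 => some 0
  | 10, 4 => some 3
  | 10, 5 => some 3
  | 10, 6 => some 4
  | 10, 7 => some 2
  | 10, 10 => some 1
  | 10, 12 => some 6
  | 10, 13 => some 8
  | 11, 3 => some 1
  | 11, 4 => some 3
  | 11, 5 => some 3
  | 11, 6 => some 4
  | 11, 7 => some 2
  | 11, 9 => some 1
  | 11, 10 => some 1
  | 11, 11 => some 1
  | 11, 12 => some 1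
  | 11, 13 => some 8
  | 12, 3 => some 1
  | 12, 5 => some 3
  | 12, 6 => some 5
  | 12, 7 => some 2
  | 12, 9 => some 1
  | 13, 3 => some 1
  | 13, 5 => some 3
  | 13, 6 => some 5
  | 13, 9 => some 1
  | 14, 2 => some 1
  | 14, 3 => some 1
  | 14, 4 => some 1
  | 14, 5 => some 1
  | 14, 6 => some 5
  | 14, 9 => some 1
  | 15, 4 => some 1
  | 15, 5 => some 1
  | 15, 6 => some 1
  | 15, 7 => some 1
  | 15, 8 => some 1
  | 15, 9 => some 1
  | _, _ => none

/-- Signal of a cell of the cross block. [cite: AboulkerEtAl2019, proof of Thm. 6 (p. 5 L53 – p. 6 L19), crossover gadget — this file's NAND/XOR version, not the printed one] -/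
def crossSig (c : Cell) : Option (Fin 14) := crossSigNat c.1.val c.2.val

/-- Value of signal `s` of the cross block as a function of the port inputs (the unique satisfying
extension; machine-found). [cite: AboulkerEtAl2019, proof of Thm. 6 (p. 5 L53 – p. 6 L19), crossover gadget — this file's NAND/XOR version, not the printed one] -/
def crossSigVal : Fin 14 → Bool → Bool → Bool
  | ⟨0, _⟩ => fun x y => match x, y with | false, false => false | false, true => false | true, false => true | true, true => true   -- A
  | ⟨1, _⟩ => fun x y => match x, y with | false, false => false | false, true => true | true, false => false | true, true => true   -- B
  | ⟨2, _⟩ => fun x y => match x, y with | false, false => false | false, true => true | true, false => true | true, true => false   -- C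
  | ⟨3, _⟩ => fun x y => match x, y with | false, false => true | false, true => true | true, false => true | true, true => false   -- g1m
  | ⟨4, _⟩ => fun x y => match x, y with | false, false => true | false, true => true | true, false => false | true, true => true   -- g1p
  | ⟨5, _⟩ => fun x y => match x, y with | false, false => true | false, true => false | true, false => true | true, true => true   -- g1q
  | ⟨6, _⟩ => fun x y => match x, y with | false, false => true | false, true => false | true, false => true | true, true => true   -- g2m
  | ⟨7, _⟩ => fun x y => match x, y with | false, false => true | false, true => true | true, false => false | true, true => true   -- g2p
  | ⟨8, _⟩ => fun x y => match x, y with | false, false => true | false, true => true | true, false => true | true, true => false   -- g2q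
  | ⟨9, _⟩ => fun x y => match x, y with | false, false => true | false, true => true | true, false => false | true, true => true   -- g3m
  | ⟨10, _⟩ => fun x y => match x, y with | false, false => true | false, true => true | true, false => true | true, true => false   -- g3p
  | ⟨11, _⟩ => fun x y => match x, y with | false, false => true | false, true => false | true, false => true | true, true => true   -- g3q
  | ⟨12, _⟩ => fun x y => match x, y with | false, false => false | false, true => false | true, false => true | true, true => true   -- Ap
  | ⟨13, _⟩ => fun x y => match x, y with | false, false => false | false, true => true | true, false => false | true, true => true   -- Bp

/-- The LIFT assignment of the cross block: value of a cell as a function of the port inputs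
(unconstrained cells ↦ `false`). [cite: AboulkerEtAl2019, proof of Thm. 6 (p. 5 L53 – p. 6 L19), crossover gadget — this file's NAND/XOR version, not the printed one] -/
def crossVal (c : Cell) (x y : Bool) : Bool :=
  match crossSig c with
  | none => false
  | some s => crossSigVal s x y

/-- Representative cell of each signal (BFS root of its wire). [cite: AboulkerEtAl2019, proof of Thm. 6 (p. 5 L53 – p. 6 L19), crossover gadget — this file's NAND/XOR version, not the printed one] -/
def crossRep : Fin 14 → Cell
  | ⟨0, _⟩ => (3, 1)   -- A
  | ⟨1, _⟩ => (8, 10)   -- B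
  | ⟨2, _⟩ => (3, 7)   -- C
  | ⟨3, _⟩ => (9, 5)   -- g1m
  | ⟨4, _⟩ => (8, 6)   -- g1p
  | ⟨5, _⟩ => (12, 6)   -- g1q
  | ⟨6, _⟩ => (6, 12)   -- g2m
  | ⟨7, _⟩ => (5, 13)   -- g2p
  | ⟨8, _⟩ => (9, 13)   -- g2q
  | ⟨9, _⟩ => (3, 2)   -- g3m
  | ⟨10, _⟩ => (2, 1)   -- g3p
  | ⟨11, _⟩ => (2, 5)   -- g3q
  | ⟨12, _⟩ => (8, 14)   -- Ap
  | ⟨13, _⟩ => (0, 4)   -- Bp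

/-- The 97 grid-adjacent same-signal cell pairs (WIRE rows), in BFS order from the representatives
(each pair's first cell is a representative or occurs in an earlier pair). [cite: AboulkerEtAl2019, proof of Thm. 6 (p. 5 L53 – p. 6 L19), crossover gadget — this file's NAND/XOR version, not the printed one] -/
def crossWirePairs : List (Cell × Cell) :=
  [((3, 1), (4, 1)),
   ((4, 1), (5, 1)),
   ((5, 1), (5, 2)),
   ((5, 1), (6, 1)),
   ((5, 2), (5, 3)),
   ((6, 1), (6, 0)),
   ((6, 0), (7, 0)),
   ((7, 0), (8, 0)),
   ((8, 0), (8, 1)),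
   ((8, 1), (8, 2)),
   ((8, 2), (8, 3)),
   ((8, 3), (8, 4)),
   ((8, 3), (9, 3)),
   ((8, 4), (8, 5)),
   ((9, 3), (10, 3)),
   ((8, 10), (9, 10)),
   ((9, 10), (10, 10)),
   ((10, 10), (11, 10)),
   ((11, 10), (11, 9)),
   ((11, 10), (11, 11)),
   ((11, 9), (12, 9)),
   ((11, 11), (11, 12)),
   ((12, 9), (13, 9)),
   ((13, 9), (14, 9)),
   ((14, 9), (15, 9)),
   ((15, 9), (15, 8)),
   ((15, 8), (15, 7)),
   ((15, 7), (15, 6)),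
   ((15, 6), (15, 5)),
   ((15, 5), (14, 5)),
   ((15, 5), (15, 4)),
   ((14, 5), (14, 4)),
   ((15, 4), (14, 4)),
   ((14, 4), (14, 3)),
   ((14, 3), (13, 3)),
   ((14, 3), (14, 2)),
   ((13, 3), (12, 3)),
   ((12, 3), (11, 3)),
   ((3, 7), (4, 7)),
   ((4, 7), (5, 7)),
   ((5, 7), (5, 6)),
   ((5, 7), (5, 8)),
   ((5, 7), (6, 7)),
   ((5, 6), (5, 5)),
   ((5, 8), (5, 9)),
   ((6, 7), (7, 7)),
   ((5, 5), (5, 4)),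
   ((5, 9), (5, 10)),
   ((7, 7), (8, 7)),
   ((5, 10), (5, 11)),
   ((5, 10), (6, 10)),
   ((8, 7), (9, 7)),
   ((5, 11), (5, 12)),
   ((6, 10), (7, 10)),
   ((9, 7), (10, 7)),
   ((10, 7), (11, 7)),
   ((11, 7), (12, 7)),
   ((9, 5), (10, 5)),
   ((10, 5), (10, 4)),
   ((10, 5), (11, 5)),
   ((10, 4), (11, 4)),
   ((11, 5), (11, 4)),
   ((11, 5), (12, 5)),
   ((12, 5), (13, 5)),
   ((8, 6), (9, 6)),
   ((9, 6), (10, 6)),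
   ((10, 6), (11, 6)),
   ((12, 6), (13, 6)),
   ((13, 6), (14, 6)),
   ((6, 12), (7, 12)),
   ((7, 12), (7, 11)),
   ((7, 12), (8, 12)),
   ((7, 11), (8, 11)),
   ((8, 12), (8, 11)),
   ((8, 12), (9, 12)),
   ((9, 12), (10, 12)),
   ((5, 13), (6, 13)),
   ((6, 13), (7, 13)),
   ((7, 13), (8, 13)),
   ((9, 13), (10, 13)),
   ((10, 13), (11, 13)),
   ((3, 2), (3, 3)),
   ((3, 3), (3, 4)),
   ((3, 3), (4, 3)),
   ((3, 4), (3, 5)),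
   ((3, 4), (4, 4)),
   ((4, 3), (4, 4)),
   ((3, 5), (3, 6)),
   ((2, 1), (2, 2)),
   ((2, 2), (2, 3)),
   ((2, 3), (2, 4)),
   ((2, 5), (2, 6)),
   ((2, 6), (2, 7)),
   ((8, 14), (8, 15)),
   ((8, 14), (9, 14)),
   ((0, 4), (1, 4)),
   ((1, 4), (1, 5))]

/-- The 12 NAND gates `(u, v, w, z)`: 4-cycle `u–v–w–z–u`, inputs `u, v`, output wire `{w, z}`.
[cite: AboulkerEtAl2019, proof of Thm. 6 (p. 5 L53 – p. 6 L19), crossover gadget — this file's NAND/XOR version, not the printed one] -/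
def crossGates : List (Cell × Cell × Cell × Cell) :=
  [((10, 3), (11, 3), (11, 4), (10, 4)),
   ((8, 5), (9, 5), (9, 6), (8, 6)),
   ((14, 5), (13, 5), (13, 6), (14, 6)),
   ((11, 6), (12, 6), (12, 7), (11, 7)),
   ((5, 3), (5, 4), (4, 4), (4, 3)),
   ((3, 1), (3, 2), (2, 2), (2, 1)),
   ((3, 7), (3, 6), (2, 6), (2, 7)),
   ((2, 4), (2, 5), (1, 5), (1, 4)),
   ((7, 10), (8, 10), (8, 11), (7, 11)),
   ((5, 12), (6, 12), (6, 13), (5, 13)),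
   ((11, 12), (10, 12), (10, 13), (11, 13)),
   ((8, 13), (9, 13), (9, 14), (8, 14))]

/-! #### Data of the junc block (generated from `crossover_block_K16.json` by `gen_g4.py`) -/

/-- Signal index of a role cell of the junc block (`none` = unconstrained cell); row-major two-level
table. [cite: AboulkerEtAl2019, proof of Thm. 6 (p. 5 L53 – p. 6 L19), crossover gadget — this file's NAND/XOR version, not the printed one] -/
def juncSigNat : ℕ → ℕ → Option (Fin 1)
  | 0, 4 => some 0
  | 1, 4 => some 0
  | 2, 4 => some 0
  | 3, 4 => some 0
  | 4, 4 => some 0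
  | 5, 4 => some 0
  | 6, 4 => some 0
  | 7, 4 => some 0
  | 8, 0 => some 0
  | 8, 1 => some 0
  | 8, 2 => some 0
  | 8, 3 => some 0
  | 8, 4 => some 0
  | 8, 5 => some 0
  | 8, 6 => some 0
  | 8, 7 => some 0
  | 8, 8 => some 0
  | 8, 9 => some 0
  | 8, 10 => some 0
  | 8, 11 => some 0
  | 8, 12 => some 0
  | 8, 13 => some 0
  | 8, 14 => some 0
  | 8, 15 => some 0
  | 9, 4 => some 0
  | 10, 4 => some 0
  | 11, 4 => some 0
  | 12, 4 => some 0
  | 13, 4 => some 0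
  | 14, 4 => some 0
  | 15, 4 => some 0
  | _, _ => none

/-- Signal of a cell of the junc block. [cite: AboulkerEtAl2019, proof of Thm. 6 (p. 5 L53 – p. 6 L19), crossover gadget — this file's NAND/XOR version, not the printed one] -/
def juncSig (c : Cell) : Option (Fin 1) := juncSigNat c.1.val c.2.val

/-- Value of signal `s` of the junc block as a function of the port inputs (the unique satisfying
extension; machine-found). [cite: AboulkerEtAl2019, proof of Thm. 6 (p. 5 L53 – p. 6 L19), crossover gadget — this file's NAND/XOR version, not the printed one] -/
def juncSigVal : Fin 1 → Bool → Bool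
  | ⟨0, _⟩ => fun x => match x with | false => false | true => true   -- W

/-- The LIFT assignment of the junc block: value of a cell as a function of the port inputs
(unconstrained cells ↦ `false`). [cite: AboulkerEtAl2019, proof of Thm. 6 (p. 5 L53 – p. 6 L19), crossover gadget — this file's NAND/XOR version, not the printed one] -/
def juncVal (c : Cell) (x : Bool) : Bool :=
  match juncSig c with
  | none => false
  | some s => juncSigVal s x

/-- Representative cell of each signal (BFS root of its wire). [cite: AboulkerEtAl2019, proof of Thm. 6 (p. 5 L53 – p. 6 L19), crossover gadget — this file's NAND/XOR version, not the printed one] -/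
def juncRep : Fin 1 → Cell
  | ⟨0, _⟩ => (0, 4)   -- W

/-- The 30 grid-adjacent same-signal cell pairs (WIRE rows), in BFS order from the representatives
(each pair's first cell is a representative or occurs in an earlier pair). [cite: AboulkerEtAl2019, proof of Thm. 6 (p. 5 L53 – p. 6 L19), crossover gadget — this file's NAND/XOR version, not the printed one] -/
def juncWirePairs : List (Cell × Cell) :=
  [((0, 4), (1, 4)),
   ((1, 4), (2, 4)),
   ((2, 4), (3, 4)),
   ((3, 4), (4, 4)),
   ((4, 4), (5, 4)),
   ((5, 4), (6, 4)),
   ((6, 4), (7, 4)),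
   ((7, 4), (8, 4)),
   ((8, 4), (8, 3)),
   ((8, 4), (8, 5)),
   ((8, 4), (9, 4)),
   ((8, 3), (8, 2)),
   ((8, 5), (8, 6)),
   ((9, 4), (10, 4)),
   ((8, 2), (8, 1)),
   ((8, 6), (8, 7)),
   ((10, 4), (11, 4)),
   ((8, 1), (8, 0)),
   ((8, 7), (8, 8)),
   ((11, 4), (12, 4)),
   ((8, 8), (8, 9)),
   ((12, 4), (13, 4)),
   ((8, 9), (8, 10)),
   ((13, 4), (14, 4)),
   ((8, 10), (8, 11)),
   ((14, 4), (15, 4)),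
   ((8, 11), (8, 12)),
   ((8, 12), (8, 13)),
   ((8, 13), (8, 14)),
   ((8, 14), (8, 15))]

/-! ### Ports, edges, representatives -/

/-- Left port (row signal in). [cite: AboulkerEtAl2019, proof of Thm. 6 (p. 5 L53 – p. 6 L19), crossover gadget — this file's NAND/XOR version, not the printed one] -/
abbrev left : Cell := (8, 0)
/-- Right port (row signal out). [cite: AboulkerEtAl2019, proof of Thm. 6 (p. 5 L53 – p. 6 L19), crossover gadget — this file's NAND/XOR version, not the printed one] -/
abbrev right : Cell := (8, 15)
/-- Top port (column signal out). [cite: AboulkerEtAl2019, proof of Thm. 6 (p. 5 L53 – p. 6 L19), crossover gadget — this file's NAND/XOR version, not the printed one] -/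
abbrev top : Cell := (0, 4)
/-- Bottom port (column signal in). [cite: AboulkerEtAl2019, proof of Thm. 6 (p. 5 L53 – p. 6 L19), crossover gadget — this file's NAND/XOR version, not the printed one] -/
abbrev bot : Cell := (15, 4)
/-- Readout cell on the row wire (adjacent to `rdB`). [cite: AboulkerEtAl2019, proof of Thm. 6 (p. 5 L53 – p. 6 L19), crossover gadget — this file's NAND/XOR version, not the printed one] -/
abbrev rdA : Cell := (10, 3)
/-- Readout cell on the column wire (adjacent to `rdA`). [cite: AboulkerEtAl2019, proof of Thm. 6 (p. 5 L53 – p. 6 L19), crossover gadget — this file's NAND/XOR version, not the printed one] -/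
abbrev rdB : Cell := (11, 3)

/-- All constrained pairs of the crossover block (wire pairs and gate cycle edges). [cite: AboulkerEtAl2019, proof of Thm. 6 (p. 5 L53 – p. 6 L19), crossover gadget — this file's NAND/XOR version, not the printed one] -/
def crossEdges : List (Cell × Cell) := crossWirePairs ++ gateEdges crossGates

/-- All constrained pairs of the junction block. [cite: AboulkerEtAl2019, proof of Thm. 6 (p. 5 L53 – p. 6 L19), crossover gadget — this file's NAND/XOR version, not the printed one] -/
def juncEdges : List (Cell × Cell) := juncWirePairs

/-- Every constrained pair of the crossover block is a unit step of the block grid (so, once the block is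
placed in `G_{t,t}`, an edge). [cite: AboulkerEtAl2019, proof of Thm. 6 (p. 5 L53 – p. 6 L19), crossover gadget — this file's NAND/XOR version, not the printed one] -/
theorem crossEdges_localAdj : ∀ e ∈ crossEdges, LocalAdj e.1 e.2 := by
  have h : (crossEdges.all fun e => decide (LocalAdj e.1 e.2)) = true := by decide
  intro e he
  exact of_decide_eq_true (List.all_eq_true.1 h e he)

/-- Every constrained pair of the junction block is a unit step. [cite: AboulkerEtAl2019, proof of Thm. 6 (p. 5 L53 – p. 6 L19), crossover gadget — this file's NAND/XOR version, not the printed one] -/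
theorem juncEdges_localAdj : ∀ e ∈ juncEdges, LocalAdj e.1 e.2 := by
  have h : (juncEdges.all fun e => decide (LocalAdj e.1 e.2)) = true := by decide
  intro e he
  exact of_decide_eq_true (List.all_eq_true.1 h e he)

/-- The readout pair is a unit step (an edge of the grid, unconstrained). [cite: AboulkerEtAl2019, proof of Thm. 6 (p. 5 L53 – p. 6 L19), crossover gadget — this file's NAND/XOR version, not the printed one] -/
theorem rd_localAdj : LocalAdj rdA rdB := by decide

/-- Representative of a cell's wire in the crossover block (itself if unconstrained). [cite: AboulkerEtAl2019, proof of Thm. 6 (p. 5 L53 – p. 6 L19), crossover gadget — this file's NAND/XOR version, not the printed one] -/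
def crossRepOf (c : Cell) : Cell :=
  match crossSig c with
  | some s => crossRep s
  | none => c

/-- Representative of a cell's wire in the junction block. [cite: AboulkerEtAl2019, proof of Thm. 6 (p. 5 L53 – p. 6 L19), crossover gadget — this file's NAND/XOR version, not the printed one] -/
def juncRepOf (c : Cell) : Cell :=
  match juncSig c with
  | some s => juncRep s
  | none => c

/-- The crossover wire list is BFS-ordered. [cite: AboulkerEtAl2019, proof of Thm. 6 (p. 5 L53 – p. 6 L19), crossover gadget — this file's NAND/XOR version, not the printed one] -/
private theorem cross_wireOrderOK : wireOrderOK crossWirePairs crossRepOf = true := by decide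

/-- The junction wire list is BFS-ordered. [cite: AboulkerEtAl2019, proof of Thm. 6 (p. 5 L53 – p. 6 L19), crossover gadget — this file's NAND/XOR version, not the printed one] -/
private theorem junc_wireOrderOK : wireOrderOK juncWirePairs juncRepOf = true := by decide

/-! ### The rows -/

section Rows

variable {V : Type} [Fintype V] [DecidableEq V] (G : SimpleGraph V) [DecidableRel G.Adj] (ι : Cell → V)

/-- Row index of the crossover block: wire pairs (forward), wire pairs (backward), gates. [cite: AboulkerEtAl2019, proof of Thm. 6 (p. 5 L53 – p. 6 L19), crossover gadget — this file's NAND/XOR version, not the printed one] -/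
abbrev CrossIx : Type := Fin crossWirePairs.length ⊕ Fin crossWirePairs.length ⊕ Fin crossGates.length

/-- Row index of the junction block. [cite: AboulkerEtAl2019, proof of Thm. 6 (p. 5 L53 – p. 6 L19), crossover gadget — this file's NAND/XOR version, not the printed one] -/
abbrev JuncIx : Type := Fin juncWirePairs.length ⊕ Fin juncWirePairs.length

/-- The rows of the crossover block placed by `ι`: `x_{pq} − x_p ≤ 0`, `x_{qp} − x_q ≤ 0` for each wire pair
and the NAND row of each gate. [cite: AboulkerEtAl2019, proof of Thm. 6 (p. 6 L3, L17) — wires as printed; the gate rows are this file's construction] -/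
def crossCv : CrossIx → (V × V → ℝ)
  | Sum.inl k => Pi.single (ι (crossWirePairs[k]).1, ι (crossWirePairs[k]).2) 1 -
      Pi.single (ι (crossWirePairs[k]).1, ι (crossWirePairs[k]).1) 1
  | Sum.inr (Sum.inl k) => Pi.single (ι (crossWirePairs[k]).2, ι (crossWirePairs[k]).1) 1 -
      Pi.single (ι (crossWirePairs[k]).2, ι (crossWirePairs[k]).2) 1
  | Sum.inr (Sum.inr k) => fvec (nandRow (ι (crossGates[k]).1) (ι (crossGates[k]).2.1)
      (ι (crossGates[k]).2.2.1) (ι (crossGates[k]).2.2.2))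

/-- Right-hand sides of the crossover rows (`0`, `0`, `3`). [cite: AboulkerEtAl2019, proof of Thm. 6 (p. 5 L53 – p. 6 L19), crossover gadget — this file's NAND/XOR version, not the printed one] -/
def crossRhs : CrossIx → ℝ
  | Sum.inl _ => 0
  | Sum.inr (Sum.inl _) => 0
  | Sum.inr (Sum.inr _) => 3

/-- The rows of the junction block (wires only). [cite: AboulkerEtAl2019, proof of Thm. 6 (p. 6 L17)] -/
def juncCv : JuncIx → (V × V → ℝ)
  | Sum.inl k => Pi.single (ι (juncWirePairs[k]).1, ι (juncWirePairs[k]).2) 1 -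
      Pi.single (ι (juncWirePairs[k]).1, ι (juncWirePairs[k]).1) 1
  | Sum.inr k => Pi.single (ι (juncWirePairs[k]).2, ι (juncWirePairs[k]).1) 1 -
      Pi.single (ι (juncWirePairs[k]).2, ι (juncWirePairs[k]).2) 1

/-- Right-hand sides of the junction rows (all `0`). [cite: AboulkerEtAl2019, proof of Thm. 6 (p. 5 L53 – p. 6 L19), crossover gadget — this file's NAND/XOR version, not the printed one] -/
def juncRhs : JuncIx → ℝ := fun _ => 0

variable {G ι}

/-- Wire pairs are constrained pairs. [cite: AboulkerEtAl2019, proof of Thm. 6 (p. 5 L53 – p. 6 L19), crossover gadget — this file's NAND/XOR version, not the printed one] -/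
private theorem crossWirePair_mem (k : Fin crossWirePairs.length) : crossWirePairs[k] ∈ crossEdges :=
  List.mem_append_left _ (List.getElem_mem _)

omit [Fintype V] [DecidableEq V] [DecidableRel G.Adj] in
/-- The four cycle edges of a gate are edges of `G`. [cite: AboulkerEtAl2019, proof of Thm. 6 (p. 5 L53 – p. 6 L19), crossover gadget — this file's NAND/XOR version, not the printed one] -/
private theorem crossGate_adj (hadj : ∀ e ∈ crossEdges, G.Adj (ι e.1) (ι e.2)) (k : Fin crossGates.length) :
    G.Adj (ι (crossGates[k]).1) (ι (crossGates[k]).2.1) ∧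
      G.Adj (ι (crossGates[k]).2.1) (ι (crossGates[k]).2.2.1) ∧
      G.Adj (ι (crossGates[k]).2.2.1) (ι (crossGates[k]).2.2.2) ∧
      G.Adj (ι (crossGates[k]).2.2.2) (ι (crossGates[k]).1) := by
  obtain ⟨h1, h2, h3, h4⟩ := mem_gateEdges (List.getElem_mem (l := crossGates) k.2)
  exact ⟨hadj _ (List.mem_append_right _ h1), hadj _ (List.mem_append_right _ h2),
    hadj _ (List.mem_append_right _ h3), hadj _ (List.mem_append_right _ h4)⟩

/-- **(V) Validity**: every row of the crossover block is valid on every generator `corVec G b`, as soon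
as the constrained pairs are edges of `G`. [cite: AboulkerEtAl2019, proof of Thm. 6 (p. 6 L3 "originate from valid inequalities")] -/
theorem cross_valid (hadj : ∀ e ∈ crossEdges, G.Adj (ι e.1) (ι e.2)) (r : CrossIx) (b : V → Bool) :
    crossCv ι r ⬝ᵥ corVec G b ≤ crossRhs r := by
  rcases r with k | k | k
  · exact wire_dotProduct_corVec_le b (hadj _ (crossWirePair_mem k))
  · exact wire_dotProduct_corVec_le b (hadj _ (crossWirePair_mem k)).symm
  · obtain ⟨h1, h2, h3, h4⟩ := crossGate_adj hadj k
    exact nandRow_valid G h1 h2 h3 h4 b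

/-- **(V) Validity** of the junction rows. [cite: AboulkerEtAl2019, proof of Thm. 6 (p. 6 L17)] -/
theorem junc_valid (hadj : ∀ e ∈ juncEdges, G.Adj (ι e.1) (ι e.2)) (r : JuncIx) (b : V → Bool) :
    juncCv ι r ⬝ᵥ corVec G b ≤ juncRhs r := by
  rcases r with k | k
  · exact wire_dotProduct_corVec_le b (hadj _ (List.getElem_mem _))
  · exact wire_dotProduct_corVec_le b (hadj _ (List.getElem_mem _)).symm

/-- Two tight wire rows on an edge give equal Boolean values. [cite: AboulkerEtAl2019, proof of Thm. 6 (p. 6 L17–19)] -/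
private theorem bool_eq_of_wire_rows {u v : V} (h : G.Adj u v) (b : V → Bool)
    (h1 : (Pi.single (u, v) (1 : ℝ) - Pi.single (u, u) 1) ⬝ᵥ corVec G b = 0)
    (h2 : (Pi.single (v, u) (1 : ℝ) - Pi.single (v, v) 1) ⬝ᵥ corVec G b = 0) : b u = b v := by
  have a1 := (wire_dotProduct_corVec_eq_zero_iff b h).1 h1
  have a2 := (wire_dotProduct_corVec_eq_zero_iff b h.symm).1 h2
  cases hu : b u <;> cases hv : b v <;> simp_all

end Rows


/-! ### (L) completeness and (D) soundness of the crossover block -/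

section CrossBlock

variable {V : Type} [Fintype V] [DecidableEq V] {G : SimpleGraph V} [DecidableRel G.Adj] {ι : Cell → V}

/-- Along every wire pair the LIFT table takes equal values. [cite: AboulkerEtAl2019, proof of Thm. 6 (p. 5 L53 – p. 6 L19), crossover gadget — this file's NAND/XOR version, not the printed one] -/
private theorem crossWire_val : ∀ x y : Bool,
    (crossWirePairs.all fun pq => crossVal pq.1 x y == crossVal pq.2 x y) = true := by decide

/-- At every gate the LIFT table satisfies the NAND relation (and the output wire is constant).
[cite: AboulkerEtAl2019, proof of Thm. 6 (p. 5 L53 – p. 6 L19), crossover gadget — this file's NAND/XOR version, not the printed one] -/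
private theorem crossGate_val : ∀ x y : Bool,
    (crossGates.all fun g => (crossVal g.2.2.1 x y == crossVal g.2.2.2 x y) &&
      (crossVal g.2.2.2 x y == !(crossVal g.1 x y && crossVal g.2.1 x y))) = true := by decide

/-- The LIFT table at the ports and readout cells: row value on left/right/`rdA`, column value on
top/bottom/`rdB`. [cite: AboulkerEtAl2019, proof of Thm. 6 (p. 5 L53 – p. 6 L19), crossover gadget — this file's NAND/XOR version, not the printed one] -/
theorem crossVal_ports : ∀ x y : Bool, crossVal left x y = x ∧ crossVal right x y = x ∧
    crossVal top x y = y ∧ crossVal bot x y = y ∧ crossVal rdA x y = x ∧ crossVal rdB x y = y := by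
  decide

/-- **(L) Completeness of the crossover block**: the explicit assignment `crossVal · x y` (transported by
`ι`) makes every row tight. [cite: AboulkerEtAl2019, proof of Thm. 6 (p. 6 L14–19) — for this file's gadget] -/
theorem cross_lift (hadj : ∀ e ∈ crossEdges, G.Adj (ι e.1) (ι e.2)) (x y : Bool) (b : V → Bool)
    (hb : ∀ c : Cell, b (ι c) = crossVal c x y) (r : CrossIx) :
    crossCv ι r ⬝ᵥ corVec G b = crossRhs r := by
  rcases r with k | k | k
  · have hv := List.all_eq_true.1 (crossWire_val x y) _ (List.getElem_mem k.2)
    rw [beq_iff_eq] at hv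
    refine (wire_dotProduct_corVec_eq_zero_iff b (hadj _ (crossWirePair_mem k))).2 ?_
    rw [hb, hb]
    intro h
    exact hv ▸ h
  · have hv := List.all_eq_true.1 (crossWire_val x y) _ (List.getElem_mem k.2)
    rw [beq_iff_eq] at hv
    refine (wire_dotProduct_corVec_eq_zero_iff b (hadj _ (crossWirePair_mem k)).symm).2 ?_
    rw [hb, hb]
    intro h
    exact hv.symm ▸ h
  · obtain ⟨h1, h2, h3, h4⟩ := crossGate_adj hadj k
    have hv := List.all_eq_true.1 (crossGate_val x y) _ (List.getElem_mem k.2)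
    simp only [Bool.and_eq_true, beq_iff_eq] at hv
    refine ((nandRow_tight_iff G h1 h2 h3 h4 b).2 ⟨?_, ?_⟩).1
    · rw [hb, hb]; exact hv.1
    · rw [hb, hb, hb]; exact hv.2

/-- The Boolean core of the crossover: three XORs of four NANDs each transmit `(a, b)` to the right / top
ports. [folklore] -/
private theorem cross_bool (a bb c m1 p1 q1 m2 p2 q2 m3 p3 q3 ap bp : Bool)
    (h0 : m1 = !(a && bb)) (h1 : p1 = !(a && m1)) (h2 : q1 = !(bb && m1)) (h3 : c = !(p1 && q1))
    (h4 : m3 = !(a && c)) (h5 : p3 = !(a && m3)) (h6 : q3 = !(c && m3)) (h7 : bp = !(p3 && q3))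
    (h8 : m2 = !(c && bb)) (h9 : p2 = !(c && m2)) (h10 : q2 = !(bb && m2)) (h11 : ap = !(p2 && q2)) :
    ap = a ∧ bp = bb := by
  subst h0 h1 h2 h3 h4 h5 h6 h7 h8 h9 h10 h11
  revert a bb
  decide

/-- **(D) Soundness of the crossover block**: if every row is tight at the generator `corVec G b`, the
right port repeats the left port, the top port repeats the bottom port, and the readout cells carry the
two port values. [cite: AboulkerEtAl2019, proof of Thm. 6 (p. 5 L58–60: "the gadgets make sure that propagation along vertical paths does not interfere with propagation along horizontal paths") — for this file's gadget] -/
theorem cross_desc (hadj : ∀ e ∈ crossEdges, G.Adj (ι e.1) (ι e.2)) (b : V → Bool)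
    (ht : ∀ r : CrossIx, crossCv ι r ⬝ᵥ corVec G b = crossRhs r) :
    b (ι right) = b (ι left) ∧ b (ι top) = b (ι bot) ∧ b (ι rdA) = b (ι left) ∧
      b (ι rdB) = b (ι bot) := by
  have hw : ∀ n (h : n < crossWirePairs.length),
      (fun c => b (ι c)) (crossWirePairs[n]).1 = (fun c => b (ι c)) (crossWirePairs[n]).2 :=
    fun n h => bool_eq_of_wire_rows (hadj _ (crossWirePair_mem ⟨n, h⟩)) b (ht (Sum.inl ⟨n, h⟩))
      (ht (Sum.inr (Sum.inl ⟨n, h⟩)))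
  have hc := reach_cell crossWirePairs crossRepOf cross_wireOrderOK (fun c => b (ι c)) hw
  have c_8_0 : b (ι (8, 0)) = b (ι (3, 1)) := hc (8, 0) ⟨7, by decide, Or.inr rfl⟩
  have c_8_15 : b (ι (8, 15)) = b (ι (8, 14)) := hc (8, 15) ⟨93, by decide, Or.inr rfl⟩
  have c_0_4 : b (ι (0, 4)) = b (ι (0, 4)) := hc (0, 4) ⟨95, by decide, Or.inl rfl⟩
  have c_15_4 : b (ι (15, 4)) = b (ι (8, 10)) := hc (15, 4) ⟨30, by decide, Or.inr rfl⟩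
  have c_10_3 : b (ι (10, 3)) = b (ι (3, 1)) := hc (10, 3) ⟨14, by decide, Or.inr rfl⟩
  have c_11_3 : b (ι (11, 3)) = b (ι (8, 10)) := hc (11, 3) ⟨37, by decide, Or.inr rfl⟩
  have c_11_4 : b (ι (11, 4)) = b (ι (9, 5)) := hc (11, 4) ⟨60, by decide, Or.inr rfl⟩
  have c_10_4 : b (ι (10, 4)) = b (ι (9, 5)) := hc (10, 4) ⟨58, by decide, Or.inr rfl⟩
  have c_8_5 : b (ι (8, 5)) = b (ι (3, 1)) := hc (8, 5) ⟨13, by decide, Or.inr rfl⟩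
  have c_9_5 : b (ι (9, 5)) = b (ι (9, 5)) := hc (9, 5) ⟨57, by decide, Or.inl rfl⟩
  have c_9_6 : b (ι (9, 6)) = b (ι (8, 6)) := hc (9, 6) ⟨64, by decide, Or.inr rfl⟩
  have c_8_6 : b (ι (8, 6)) = b (ι (8, 6)) := hc (8, 6) ⟨64, by decide, Or.inl rfl⟩
  have c_14_5 : b (ι (14, 5)) = b (ι (8, 10)) := hc (14, 5) ⟨29, by decide, Or.inr rfl⟩
  have c_13_5 : b (ι (13, 5)) = b (ι (9, 5)) := hc (13, 5) ⟨63, by decide, Or.inr rfl⟩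
  have c_13_6 : b (ι (13, 6)) = b (ι (12, 6)) := hc (13, 6) ⟨67, by decide, Or.inr rfl⟩
  have c_14_6 : b (ι (14, 6)) = b (ι (12, 6)) := hc (14, 6) ⟨68, by decide, Or.inr rfl⟩
  have c_11_6 : b (ι (11, 6)) = b (ι (8, 6)) := hc (11, 6) ⟨66, by decide, Or.inr rfl⟩
  have c_12_6 : b (ι (12, 6)) = b (ι (12, 6)) := hc (12, 6) ⟨67, by decide, Or.inl rfl⟩
  have c_12_7 : b (ι (12, 7)) = b (ι (3, 7)) := hc (12, 7) ⟨56, by decide, Or.inr rfl⟩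
  have c_11_7 : b (ι (11, 7)) = b (ι (3, 7)) := hc (11, 7) ⟨55, by decide, Or.inr rfl⟩
  have c_5_3 : b (ι (5, 3)) = b (ι (3, 1)) := hc (5, 3) ⟨4, by decide, Or.inr rfl⟩
  have c_5_4 : b (ι (5, 4)) = b (ι (3, 7)) := hc (5, 4) ⟨46, by decide, Or.inr rfl⟩
  have c_4_4 : b (ι (4, 4)) = b (ι (3, 2)) := hc (4, 4) ⟨85, by decide, Or.inr rfl⟩
  have c_4_3 : b (ι (4, 3)) = b (ι (3, 2)) := hc (4, 3) ⟨83, by decide, Or.inr rfl⟩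
  have c_3_1 : b (ι (3, 1)) = b (ι (3, 1)) := hc (3, 1) ⟨0, by decide, Or.inl rfl⟩
  have c_3_2 : b (ι (3, 2)) = b (ι (3, 2)) := hc (3, 2) ⟨81, by decide, Or.inl rfl⟩
  have c_2_2 : b (ι (2, 2)) = b (ι (2, 1)) := hc (2, 2) ⟨88, by decide, Or.inr rfl⟩
  have c_2_1 : b (ι (2, 1)) = b (ι (2, 1)) := hc (2, 1) ⟨88, by decide, Or.inl rfl⟩
  have c_3_7 : b (ι (3, 7)) = b (ι (3, 7)) := hc (3, 7) ⟨38, by decide, Or.inl rfl⟩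
  have c_3_6 : b (ι (3, 6)) = b (ι (3, 2)) := hc (3, 6) ⟨87, by decide, Or.inr rfl⟩
  have c_2_6 : b (ι (2, 6)) = b (ι (2, 5)) := hc (2, 6) ⟨91, by decide, Or.inr rfl⟩
  have c_2_7 : b (ι (2, 7)) = b (ι (2, 5)) := hc (2, 7) ⟨92, by decide, Or.inr rfl⟩
  have c_2_4 : b (ι (2, 4)) = b (ι (2, 1)) := hc (2, 4) ⟨90, by decide, Or.inr rfl⟩
  have c_2_5 : b (ι (2, 5)) = b (ι (2, 5)) := hc (2, 5) ⟨91, by decide, Or.inl rfl⟩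
  have c_1_5 : b (ι (1, 5)) = b (ι (0, 4)) := hc (1, 5) ⟨96, by decide, Or.inr rfl⟩
  have c_1_4 : b (ι (1, 4)) = b (ι (0, 4)) := hc (1, 4) ⟨95, by decide, Or.inr rfl⟩
  have c_7_10 : b (ι (7, 10)) = b (ι (3, 7)) := hc (7, 10) ⟨53, by decide, Or.inr rfl⟩
  have c_8_10 : b (ι (8, 10)) = b (ι (8, 10)) := hc (8, 10) ⟨15, by decide, Or.inl rfl⟩
  have c_8_11 : b (ι (8, 11)) = b (ι (6, 12)) := hc (8, 11) ⟨72, by decide, Or.inr rfl⟩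
  have c_7_11 : b (ι (7, 11)) = b (ι (6, 12)) := hc (7, 11) ⟨70, by decide, Or.inr rfl⟩
  have c_5_12 : b (ι (5, 12)) = b (ι (3, 7)) := hc (5, 12) ⟨52, by decide, Or.inr rfl⟩
  have c_6_12 : b (ι (6, 12)) = b (ι (6, 12)) := hc (6, 12) ⟨69, by decide, Or.inl rfl⟩
  have c_6_13 : b (ι (6, 13)) = b (ι (5, 13)) := hc (6, 13) ⟨76, by decide, Or.inr rfl⟩
  have c_5_13 : b (ι (5, 13)) = b (ι (5, 13)) := hc (5, 13) ⟨76, by decide, Or.inl rfl⟩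
  have c_11_12 : b (ι (11, 12)) = b (ι (8, 10)) := hc (11, 12) ⟨21, by decide, Or.inr rfl⟩
  have c_10_12 : b (ι (10, 12)) = b (ι (6, 12)) := hc (10, 12) ⟨75, by decide, Or.inr rfl⟩
  have c_10_13 : b (ι (10, 13)) = b (ι (9, 13)) := hc (10, 13) ⟨79, by decide, Or.inr rfl⟩
  have c_11_13 : b (ι (11, 13)) = b (ι (9, 13)) := hc (11, 13) ⟨80, by decide, Or.inr rfl⟩
  have c_8_13 : b (ι (8, 13)) = b (ι (5, 13)) := hc (8, 13) ⟨78, by decide, Or.inr rfl⟩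
  have c_9_13 : b (ι (9, 13)) = b (ι (9, 13)) := hc (9, 13) ⟨79, by decide, Or.inl rfl⟩
  have c_9_14 : b (ι (9, 14)) = b (ι (8, 14)) := hc (9, 14) ⟨94, by decide, Or.inr rfl⟩
  have c_8_14 : b (ι (8, 14)) = b (ι (8, 14)) := hc (8, 14) ⟨93, by decide, Or.inl rfl⟩
  have g0 : b (ι (9, 5)) = !(b (ι (3, 1)) && b (ι (8, 10))) := by
    have a1 : G.Adj (ι (10, 3)) (ι (11, 3)) := hadj ((10, 3), (11, 3)) (by decide)
    have a2 : G.Adj (ι (11, 3)) (ι (11, 4)) := hadj ((11, 3), (11, 4)) (by decide)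
    have a3 : G.Adj (ι (11, 4)) (ι (10, 4)) := hadj ((11, 4), (10, 4)) (by decide)
    have a4 : G.Adj (ι (10, 4)) (ι (10, 3)) := hadj ((10, 4), (10, 3)) (by decide)
    have t := ((nandRow_tight_iff G a1 a2 a3 a4 b).1
      ⟨ht (Sum.inr (Sum.inr ⟨0, by decide⟩)), c_11_4.trans c_10_4.symm⟩).2
    rw [c_10_4, c_10_3, c_11_3] at t
    exact t
  have g1 : b (ι (8, 6)) = !(b (ι (3, 1)) && b (ι (9, 5))) := by
    have a1 : G.Adj (ι (8, 5)) (ι (9, 5)) := hadj ((8, 5), (9, 5)) (by decide)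
    have a2 : G.Adj (ι (9, 5)) (ι (9, 6)) := hadj ((9, 5), (9, 6)) (by decide)
    have a3 : G.Adj (ι (9, 6)) (ι (8, 6)) := hadj ((9, 6), (8, 6)) (by decide)
    have a4 : G.Adj (ι (8, 6)) (ι (8, 5)) := hadj ((8, 6), (8, 5)) (by decide)
    have t := ((nandRow_tight_iff G a1 a2 a3 a4 b).1
      ⟨ht (Sum.inr (Sum.inr ⟨1, by decide⟩)), c_9_6.trans c_8_6.symm⟩).2
    rw [c_8_5] at t
    exact t
  have g2 : b (ι (12, 6)) = !(b (ι (8, 10)) && b (ι (9, 5))) := by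
    have a1 : G.Adj (ι (14, 5)) (ι (13, 5)) := hadj ((14, 5), (13, 5)) (by decide)
    have a2 : G.Adj (ι (13, 5)) (ι (13, 6)) := hadj ((13, 5), (13, 6)) (by decide)
    have a3 : G.Adj (ι (13, 6)) (ι (14, 6)) := hadj ((13, 6), (14, 6)) (by decide)
    have a4 : G.Adj (ι (14, 6)) (ι (14, 5)) := hadj ((14, 6), (14, 5)) (by decide)
    have t := ((nandRow_tight_iff G a1 a2 a3 a4 b).1
      ⟨ht (Sum.inr (Sum.inr ⟨2, by decide⟩)), c_13_6.trans c_14_6.symm⟩).2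
    rw [c_14_6, c_14_5, c_13_5] at t
    exact t
  have g3 : b (ι (3, 7)) = !(b (ι (8, 6)) && b (ι (12, 6))) := by
    have a1 : G.Adj (ι (11, 6)) (ι (12, 6)) := hadj ((11, 6), (12, 6)) (by decide)
    have a2 : G.Adj (ι (12, 6)) (ι (12, 7)) := hadj ((12, 6), (12, 7)) (by decide)
    have a3 : G.Adj (ι (12, 7)) (ι (11, 7)) := hadj ((12, 7), (11, 7)) (by decide)
    have a4 : G.Adj (ι (11, 7)) (ι (11, 6)) := hadj ((11, 7), (11, 6)) (by decide)
    have t := ((nandRow_tight_iff G a1 a2 a3 a4 b).1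
      ⟨ht (Sum.inr (Sum.inr ⟨3, by decide⟩)), c_12_7.trans c_11_7.symm⟩).2
    rw [c_11_7, c_11_6] at t
    exact t
  have g4 : b (ι (3, 2)) = !(b (ι (3, 1)) && b (ι (3, 7))) := by
    have a1 : G.Adj (ι (5, 3)) (ι (5, 4)) := hadj ((5, 3), (5, 4)) (by decide)
    have a2 : G.Adj (ι (5, 4)) (ι (4, 4)) := hadj ((5, 4), (4, 4)) (by decide)
    have a3 : G.Adj (ι (4, 4)) (ι (4, 3)) := hadj ((4, 4), (4, 3)) (by decide)
    have a4 : G.Adj (ι (4, 3)) (ι (5, 3)) := hadj ((4, 3), (5, 3)) (by decide)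
    have t := ((nandRow_tight_iff G a1 a2 a3 a4 b).1
      ⟨ht (Sum.inr (Sum.inr ⟨4, by decide⟩)), c_4_4.trans c_4_3.symm⟩).2
    rw [c_4_3, c_5_3, c_5_4] at t
    exact t
  have g5 : b (ι (2, 1)) = !(b (ι (3, 1)) && b (ι (3, 2))) := by
    have a1 : G.Adj (ι (3, 1)) (ι (3, 2)) := hadj ((3, 1), (3, 2)) (by decide)
    have a2 : G.Adj (ι (3, 2)) (ι (2, 2)) := hadj ((3, 2), (2, 2)) (by decide)
    have a3 : G.Adj (ι (2, 2)) (ι (2, 1)) := hadj ((2, 2), (2, 1)) (by decide)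
    have a4 : G.Adj (ι (2, 1)) (ι (3, 1)) := hadj ((2, 1), (3, 1)) (by decide)
    have t := ((nandRow_tight_iff G a1 a2 a3 a4 b).1
      ⟨ht (Sum.inr (Sum.inr ⟨5, by decide⟩)), c_2_2.trans c_2_1.symm⟩).2
    exact t
  have g6 : b (ι (2, 5)) = !(b (ι (3, 7)) && b (ι (3, 2))) := by
    have a1 : G.Adj (ι (3, 7)) (ι (3, 6)) := hadj ((3, 7), (3, 6)) (by decide)
    have a2 : G.Adj (ι (3, 6)) (ι (2, 6)) := hadj ((3, 6), (2, 6)) (by decide)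
    have a3 : G.Adj (ι (2, 6)) (ι (2, 7)) := hadj ((2, 6), (2, 7)) (by decide)
    have a4 : G.Adj (ι (2, 7)) (ι (3, 7)) := hadj ((2, 7), (3, 7)) (by decide)
    have t := ((nandRow_tight_iff G a1 a2 a3 a4 b).1
      ⟨ht (Sum.inr (Sum.inr ⟨6, by decide⟩)), c_2_6.trans c_2_7.symm⟩).2
    rw [c_2_7, c_3_6] at t
    exact t
  have g7 : b (ι (0, 4)) = !(b (ι (2, 1)) && b (ι (2, 5))) := by
    have a1 : G.Adj (ι (2, 4)) (ι (2, 5)) := hadj ((2, 4), (2, 5)) (by decide)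
    have a2 : G.Adj (ι (2, 5)) (ι (1, 5)) := hadj ((2, 5), (1, 5)) (by decide)
    have a3 : G.Adj (ι (1, 5)) (ι (1, 4)) := hadj ((1, 5), (1, 4)) (by decide)
    have a4 : G.Adj (ι (1, 4)) (ι (2, 4)) := hadj ((1, 4), (2, 4)) (by decide)
    have t := ((nandRow_tight_iff G a1 a2 a3 a4 b).1
      ⟨ht (Sum.inr (Sum.inr ⟨7, by decide⟩)), c_1_5.trans c_1_4.symm⟩).2
    rw [c_1_4, c_2_4] at t
    exact t
  have g8 : b (ι (6, 12)) = !(b (ι (3, 7)) && b (ι (8, 10))) := by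
    have a1 : G.Adj (ι (7, 10)) (ι (8, 10)) := hadj ((7, 10), (8, 10)) (by decide)
    have a2 : G.Adj (ι (8, 10)) (ι (8, 11)) := hadj ((8, 10), (8, 11)) (by decide)
    have a3 : G.Adj (ι (8, 11)) (ι (7, 11)) := hadj ((8, 11), (7, 11)) (by decide)
    have a4 : G.Adj (ι (7, 11)) (ι (7, 10)) := hadj ((7, 11), (7, 10)) (by decide)
    have t := ((nandRow_tight_iff G a1 a2 a3 a4 b).1
      ⟨ht (Sum.inr (Sum.inr ⟨8, by decide⟩)), c_8_11.trans c_7_11.symm⟩).2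
    rw [c_7_11, c_7_10] at t
    exact t
  have g9 : b (ι (5, 13)) = !(b (ι (3, 7)) && b (ι (6, 12))) := by
    have a1 : G.Adj (ι (5, 12)) (ι (6, 12)) := hadj ((5, 12), (6, 12)) (by decide)
    have a2 : G.Adj (ι (6, 12)) (ι (6, 13)) := hadj ((6, 12), (6, 13)) (by decide)
    have a3 : G.Adj (ι (6, 13)) (ι (5, 13)) := hadj ((6, 13), (5, 13)) (by decide)
    have a4 : G.Adj (ι (5, 13)) (ι (5, 12)) := hadj ((5, 13), (5, 12)) (by decide)
    have t := ((nandRow_tight_iff G a1 a2 a3 a4 b).1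
      ⟨ht (Sum.inr (Sum.inr ⟨9, by decide⟩)), c_6_13.trans c_5_13.symm⟩).2
    rw [c_5_12] at t
    exact t
  have g10 : b (ι (9, 13)) = !(b (ι (8, 10)) && b (ι (6, 12))) := by
    have a1 : G.Adj (ι (11, 12)) (ι (10, 12)) := hadj ((11, 12), (10, 12)) (by decide)
    have a2 : G.Adj (ι (10, 12)) (ι (10, 13)) := hadj ((10, 12), (10, 13)) (by decide)
    have a3 : G.Adj (ι (10, 13)) (ι (11, 13)) := hadj ((10, 13), (11, 13)) (by decide)
    have a4 : G.Adj (ι (11, 13)) (ι (11, 12)) := hadj ((11, 13), (11, 12)) (by decide)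
    have t := ((nandRow_tight_iff G a1 a2 a3 a4 b).1
      ⟨ht (Sum.inr (Sum.inr ⟨10, by decide⟩)), c_10_13.trans c_11_13.symm⟩).2
    rw [c_11_13, c_11_12, c_10_12] at t
    exact t
  have g11 : b (ι (8, 14)) = !(b (ι (5, 13)) && b (ι (9, 13))) := by
    have a1 : G.Adj (ι (8, 13)) (ι (9, 13)) := hadj ((8, 13), (9, 13)) (by decide)
    have a2 : G.Adj (ι (9, 13)) (ι (9, 14)) := hadj ((9, 13), (9, 14)) (by decide)
    have a3 : G.Adj (ι (9, 14)) (ι (8, 14)) := hadj ((9, 14), (8, 14)) (by decide)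
    have a4 : G.Adj (ι (8, 14)) (ι (8, 13)) := hadj ((8, 14), (8, 13)) (by decide)
    have t := ((nandRow_tight_iff G a1 a2 a3 a4 b).1
      ⟨ht (Sum.inr (Sum.inr ⟨11, by decide⟩)), c_9_14.trans c_8_14.symm⟩).2
    rw [c_8_13] at t
    exact t
  have hb := cross_bool (b (ι (3, 1))) (b (ι (8, 10))) (b (ι (3, 7))) (b (ι (9, 5))) (b (ι (8, 6))) (b (ι (12, 6))) (b (ι (6, 12))) (b (ι (5, 13))) (b (ι (9, 13))) (b (ι (3, 2))) (b (ι (2, 1))) (b (ι (2, 5))) (b (ι (8, 14))) (b (ι (0, 4)))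
    g0 g1 g2 g3 g4 g5 g6 g7 g8 g9 g10 g11
  exact ⟨c_8_15.trans (hb.1.trans c_8_0.symm), c_0_4.trans (hb.2.trans c_15_4.symm),
    c_10_3.trans c_8_0.symm, c_11_3.trans c_15_4.symm⟩

end CrossBlock

/-! ### (L) and (D) for the junction block -/

section JuncBlock

variable {V : Type} [Fintype V] [DecidableEq V] {G : SimpleGraph V} [DecidableRel G.Adj] {ι : Cell → V}

/-- Along every wire pair of the junction the LIFT table is constant. [cite: AboulkerEtAl2019, proof of Thm. 6 (p. 5 L53 – p. 6 L19), crossover gadget — this file's NAND/XOR version, not the printed one] -/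
private theorem juncWire_val : ∀ x : Bool,
    (juncWirePairs.all fun pq => juncVal pq.1 x == juncVal pq.2 x) = true := by decide

/-- The junction's LIFT table at the four ports. [cite: AboulkerEtAl2019, proof of Thm. 6 (p. 5 L53 – p. 6 L19), crossover gadget — this file's NAND/XOR version, not the printed one] -/
theorem juncVal_ports : ∀ x : Bool, juncVal left x = x ∧ juncVal right x = x ∧ juncVal top x = x ∧
    juncVal bot x = x := by decide

/-- Junction wire pairs are constrained pairs. [cite: AboulkerEtAl2019, proof of Thm. 6 (p. 5 L53 – p. 6 L19), crossover gadget — this file's NAND/XOR version, not the printed one] -/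
private theorem juncWirePair_mem (k : Fin juncWirePairs.length) : juncWirePairs[k] ∈ juncEdges :=
  List.getElem_mem _

/-- **(L) Completeness of the junction block.** [cite: AboulkerEtAl2019, proof of Thm. 6 (p. 6 L17–19)] -/
theorem junc_lift (hadj : ∀ e ∈ juncEdges, G.Adj (ι e.1) (ι e.2)) (x : Bool) (b : V → Bool)
    (hb : ∀ c : Cell, b (ι c) = juncVal c x) (r : JuncIx) : juncCv ι r ⬝ᵥ corVec G b = juncRhs r := by
  rcases r with k | k
  · have hv := List.all_eq_true.1 (juncWire_val x) _ (List.getElem_mem k.2)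
    rw [beq_iff_eq] at hv
    refine (wire_dotProduct_corVec_eq_zero_iff b (hadj _ (juncWirePair_mem k))).2 ?_
    rw [hb, hb]
    intro h
    exact hv ▸ h
  · have hv := List.all_eq_true.1 (juncWire_val x) _ (List.getElem_mem k.2)
    rw [beq_iff_eq] at hv
    refine (wire_dotProduct_corVec_eq_zero_iff b (hadj _ (juncWirePair_mem k)).symm).2 ?_
    rw [hb, hb]
    intro h
    exact hv.symm ▸ h

/-- **(D) Soundness of the junction block**: all four ports carry the same value. [cite: AboulkerEtAl2019, proof of Thm. 6 (p. 6 L17–19)] -/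
theorem junc_desc (hadj : ∀ e ∈ juncEdges, G.Adj (ι e.1) (ι e.2)) (b : V → Bool)
    (ht : ∀ r : JuncIx, juncCv ι r ⬝ᵥ corVec G b = juncRhs r) :
    b (ι right) = b (ι left) ∧ b (ι top) = b (ι left) ∧ b (ι bot) = b (ι left) := by
  have hw : ∀ n (h : n < juncWirePairs.length),
      (fun c => b (ι c)) (juncWirePairs[n]).1 = (fun c => b (ι c)) (juncWirePairs[n]).2 :=
    fun n h => bool_eq_of_wire_rows (hadj _ (juncWirePair_mem ⟨n, h⟩)) b (ht (Sum.inl ⟨n, h⟩))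
      (ht (Sum.inr ⟨n, h⟩))
  have hc := reach_cell juncWirePairs juncRepOf junc_wireOrderOK (fun c => b (ι c)) hw
  have jc_8_0 : b (ι (8, 0)) = b (ι (0, 4)) := hc (8, 0) ⟨17, by decide, Or.inr rfl⟩
  have jc_8_15 : b (ι (8, 15)) = b (ι (0, 4)) := hc (8, 15) ⟨29, by decide, Or.inr rfl⟩
  have jc_15_4 : b (ι (15, 4)) = b (ι (0, 4)) := hc (15, 4) ⟨25, by decide, Or.inr rfl⟩
  exact ⟨(jc_8_15).trans (jc_8_0).symm, (rfl : b (ι top) = b (ι (0, 4))).trans (jc_8_0).symm,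
    (jc_15_4).trans (jc_8_0).symm⟩

end JuncBlock


end GridCorBlock

end Literature.Combinatorics.Optimization

end
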